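import Summits.QuantumFields.YangMills.Theorems.BalabanUVNodesK0RecordFormatNamesFluct

/-!
# Bałaban UV nodes, port S1 — LIST (σ₀): the cube partitions `σ` of the torus AT A LEVEL, the cube-of-an-index maps for fine and fluctuation
# coordinates, and their adjacency BY TREE NAME (def-Y g41, ◇ lens-1 v26 §2 (σ₀) ∕ `FWPackage.cubePin`; one additive file, definitions + `rfl`-faces; nothing asserted)

WHY.  [II] p.3 L24–31: «we introduce a regular partition σ_k of the space T_η … into cubes Δ of the size R₁M₁ … For the particular example under consideration we
take cubes of the size M … We denote this family by σ₀.  To each cube Δ in this family we assign a variable s(Δ)»; [I] (3.4) p.270 (the π_k-cubes □ carrying `t_□`).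
The decoupled operator families `H(s), H₀(s), G(s)` of (1.6) are indexed by these cubes, and the LOCALITY rows (k3) of ◇'s `FWPackage` (v26 §2–§3: `CubeDecoupled Adj
cube𝔅 cube𝔄 fam.H₀s`, `CubeLocalMap Adj cube𝔄 cube𝔛 C`, …) read three data the port had no name for: the cube index type of a partition of `T^{(j)}` into `Ms`-cubes,
the CUBE OF A FINE COORDINATE `(b, a) : FineIdx F K` and OF A FLUCTUATION COORDINATE `(b′, a) : FluctIdx F k K`, and the cube adjacency.  This file words them
over the record's torus geometry — ✓`Sect2.domCount` (cubes per direction), ✓`TPt` (the index torus), ✓`coarsenTo` (the block map `T^{(0)} → T^{(j)}`),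
✓`B15DeterminingSets.embIter` (the inclusion `T^{(k)} ⊂ T^{(0)}`), ✓`TreeLengthTorus.TAdj` (wall adjacency, [I] p.257 «two consecutive cubes have a common wall») — with
the cube side `Ms` (print: `M` for σ₀, `R₁M₁` for σ_k) and the level `j` as PARAMETERS (the assembly pins them; def-Y does not guess print's scale), so that
`FWPackage`'s `σ := CubeIdxAt F Ms j K`, `cube𝔄 := cubeOfFineIdx F Ms j K`, `cube𝔅 := cubeOfFluctIdx F Ms j k K`, `Adj := TAdj` are the record's objects BY NAME
(its BINDER `cubePin` then disappears ∕ becomes `rfl`).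

WHAT THIS FILE IS (definitions only; NEW names; every earlier object untouched):
* `CubeIdxAt F Ms j K := TPt (F.P K).d (Sect2.domCount (F.P K) Ms j)` — the cubes of the partition of `T^{(j)}` of `T_K` into `Ms`-cubes (a `Fintype`; = ✓`(recordCc F Mc k K).Cube`
  at `(Ms, j) = (Mc, k+1)`).
* `cubeIdxAt F Ms j K y` — the `Ms`-cube of `T^{(j)}` containing the level-`j` site `y` (`⌊y_i ∕ Ms⌋` coordinatewise); `cubeIdxAt F Mc (k+1) K = cubeIdxOf F Mc k K` (`rfl`).
* `cubeOfFineIdx F Ms j K (b, a)` — the cube of the fine coordinate: the cube of the level-`j` block `coarsenTo j b.src` of the source site of the fine bond `b`.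
* `cubeOfFluctIdx F Ms j k K (b′, a)` — the cube of the fluctuation coordinate: the cube of `coarsenTo j (embIter k b′.src)` (the level-`k` bond's source placed in `T^{(0)}`,
  then blocked to level `j`; for `j ≤ k` this is the `Ms`-cube of `T^{(j)}` containing the centre `emb^{k−j}(b′.src)` of `b′`'s block — the cube carrying the whole block
  whenever `L^{k−j} ∣ Ms` (σ₀ at `j = k`: always, `cubeOfFluctIdx_self`)).
* faces: `cubeIdxAt_succ_eq_cubeIdxOf`, `cubeOfFineIdx_apply`, `cubeOfFluctIdx_apply` (`rfl`); `coarsenTo_embIter` (`coarsenTo k ∘ embIter k = id`, standing range), (v2, RR-2 g33 (P2)∕(P2′))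
  `cubeOfFluctIdx_self` (at `j = k`: the cube of `b′.src` itself), `cubeOfFluctIdx_succ` (at `j = k + 1`: ✓`cubeIdxOf` of `blockOf b′.src`).
Adjacency is NOT re-typed: ✓`TAdj` on `TPt` (and ✓`tnbr`, ✓`tcubeSys`) IS the cube adjacency of `CubeIdxAt`; print's □̃-neighbourhoods of (3.4) ((c3)'s `supp ζ_□ ⊆ □̃²`) are a
later, separate name if the ζ-format needs the corner-neighbour (sup-metric) reading.

HONEST SCOPE.  Index bookkeeping only (total functions, `rfl`-faces); which `(Ms, j)` is print's σ₀ at the record (`(Mc, k)`? `(M₁R₁, k)`?) and the exclusion «disjoint with the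
interior of □̃₀⁴» ([II] p.3 L27) are the assembly's choices (an index SUBSET ∕ `s ≡ 1` there), not made here.  Nothing asserted; no RG estimate.  ⟨stmt-QuantumFields-27930⟩ 2∕7 ·
K0ᴬ 0∕2 · NODE O 0∕1 · COUNT 8∕28 · K 1∕4 UNMOVED; finite `𝕋⁴_{L^K}` at fixed ε — NOT continuum ∕ OS ∕ Clay; **the Yang–Mills mass gap is NOT proved by any of this.**
No `sorry`, `instance`, `notation`.
-/

noncomputable section

namespace Summit.QuantumFields.YangMills.Theorems.K0RecordFormatNames

open Literature.MathematicalPhysics.QuantumFieldTheory.Balaban1983to89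
open Literature.MathematicalPhysics.QuantumFieldTheory.Balaban1983to89.Node00
open Literature.MathematicalPhysics.QuantumFieldTheory.Balaban1983to89.T4Continuum (T4Family)
open Literature.MathematicalPhysics.QuantumFieldTheory.Balaban1983to89.TreeLengthTorus (TPt)

variable (F : T4Family)

/-! ## §24σ  The cube partition of `T^{(j)}` into `Ms`-cubes and the cube-of-an-index maps ([II] p.3 L24–31, [I] (3.4) p.270, p.257) -/

/-- **The cubes `Δ ∈ σ` of the partition of `T^{(j)}` (of `T_K`) into `Ms`-cubes** — the index torus `(ℤ ∕ domCount)^d` of ✓`Sect2.domSys (F.P K) Ms j` (so `= (recordCc F Mc k K).Cube`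
at `(Ms, j) = (Mc, k+1)`); a `Fintype`, the `σ` of ✓`FHInterface.DecoupledOps … σ` ∕ `sPolydisc σ`.  Print: σ₀ has side `M`, σ_k side `R₁M₁` — `Ms`, `j` are PARAMETERS.
[cite: Balaban1988RG2Cluster, p.3 L24–31; Balaban1987RG1, p.257 (the cubes π_j)] -/
abbrev CubeIdxAt (Ms j K : ℕ) : Type := TPt (F.P K).d (Sect2.domCount (F.P K) Ms j)

/-- **The `Ms`-cube of `T^{(j)}` containing the level-`j` site `y`** (index `⌊y_i ∕ Ms⌋` coordinatewise; ✓`cubeIdxOf` is the case `(Ms, j) = (Mc, k+1)`, `cubeIdxAt_succ_eq_cubeIdxOf`).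
[cite: Balaban1987RG1, p.257; Balaban1988RG2Cluster, p.3 L24–31] -/
def cubeIdxAt (Ms j K : ℕ) (y : Site (F.P K) j) : CubeIdxAt F Ms j K :=
  fun i => (((y i).val / Ms : ℕ) : ZMod _)

/-- `cubeIdxAt` at `(Mc, k+1)` IS ✓`cubeIdxOf` (`rfl`). [cite: Balaban1987RG1, p.257 (bookkeeping)] -/
theorem cubeIdxAt_succ_eq_cubeIdxOf (Mc k K : ℕ) : cubeIdxAt F Mc (k + 1) K = cubeIdxOf F Mc k K := rfl

/-- **The cube of a FINE coordinate — `cubeOfFineIdx F Ms j K (b, a)`**: the `Ms`-cube of `T^{(j)}` containing the level-`j` block ✓`coarsenTo j b.src` of the source site of the fine bond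
`b` (colour-blind).  The `cube𝔄` of ◇'s `FWPackage` (v26) — the localisation cube of the variable `A ∈ 𝔄 = (FineIdx F K → ℂ)` of (1.3)∕(1.4). [cite: Balaban1988RG2Cluster, p.3 L24–31, (1.6)–(1.8) pp.3–4] -/
def cubeOfFineIdx (Ms j K : ℕ) (p : FineIdx F K) : CubeIdxAt F Ms j K :=
  cubeIdxAt F Ms j K (coarsenTo j p.1.src)

/-- **The cube of a FLUCTUATION coordinate — `cubeOfFluctIdx F Ms j k K (b′, a)`**: the `Ms`-cube of `T^{(j)}` containing ✓`coarsenTo j (embIter k b′.src)` — the source of the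
level-`k` bond `b′` placed in `T^{(0)}` (✓`B15DeterminingSets.embIter`, the inclusion `T^{(k)} ⊂ T_η`) and blocked to level `j` (colour-blind) — for `j ≤ k` the cube containing
the centre `emb^{k−j}(b′.src)` of `b′`'s block, i.e. the cube carrying the whole block whenever `L^{k−j} ∣ Ms` (σ₀ at `j = k`: always — `cubeOfFluctIdx_self`).  The `cube𝔅` of ◇'s
`FWPackage` — the localisation cube of the variable `B′ ∈ 𝔅 = (FluctIdx F k K → ℂ)` of `H₀(s)B′`. [cite: Balaban1988RG2Cluster, p.3 L24–31, (1.2) p.2; Balaban1987RG1, (0.1) p.251] -/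
def cubeOfFluctIdx (Ms j k K : ℕ) (q : FluctIdx F k K) : CubeIdxAt F Ms j K :=
  cubeIdxAt F Ms j K (coarsenTo j (B15DeterminingSets.embIter k q.1.src))

variable {F}

/-- Unfolding `cubeOfFineIdx` (`rfl`). [cite: Balaban1988RG2Cluster, p.3 L24–31 (bookkeeping)] -/
theorem cubeOfFineIdx_apply (Ms j K : ℕ) (p : FineIdx F K) :
    cubeOfFineIdx F Ms j K p = cubeIdxAt F Ms j K (coarsenTo j p.1.src) := rfl

/-- Unfolding `cubeOfFluctIdx` (`rfl`). [cite: Balaban1988RG2Cluster, p.3 L24–31 (bookkeeping)] -/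
theorem cubeOfFluctIdx_apply (Ms j k K : ℕ) (q : FluctIdx F k K) :
    cubeOfFluctIdx F Ms j k K q = cubeIdxAt F Ms j K (coarsenTo j (B15DeterminingSets.embIter k q.1.src)) := rfl

/-- `coarsenTo k ∘ embIter k = id` in the standing range `k ≤ m + K` (the recursion of ✓`B15Eq177GaugeInvariance.blockIter_embIter`, for the names file's ✓`coarsenTo`).
[cite: Balaban1985Variational, (181) p.307; Balaban1987RG1, (0.3) p.252 (bookkeeping)] -/
theorem coarsenTo_embIter {P : Params} : ∀ (k : ℕ), k ≤ P.m + P.K → ∀ y : Site P k, coarsenTo k (B15DeterminingSets.embIter k y) = y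
  | 0, _, _ => rfl
  | k + 1, hk, y => by
      show blockOf (coarsenTo k (B15DeterminingSets.embIter k (emb y))) = y
      rw [coarsenTo_embIter k (Nat.le_of_succ_le hk), Site.blockOf_emb hk]

/-- (P2) **At σ₀ = (`Ms`, `k`) the fluctuation cube is the cube of the bond's source itself**: `cubeOfFluctIdx F Ms k k K (b′, a) = cubeIdxAt F Ms k K b′.src` (standing range) — ◇'s (k3)
locality rows rewrite `cube𝔅` by this name. [cite: Balaban1988RG2Cluster, p.3 L24–27 («cubes Δ of the size R₁M₁»); Balaban1987RG1, (0.3) p.252] -/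
theorem cubeOfFluctIdx_self (Ms k K : ℕ) (hk : k ≤ (F.P K).m + (F.P K).K) (q : FluctIdx F k K) :
    cubeOfFluctIdx F Ms k k K q = cubeIdxAt F Ms k K q.1.src := by
  rw [cubeOfFluctIdx_apply, coarsenTo_embIter k hk]

/-- (P2′) **At `j = k + 1`** the fluctuation cube is ✓`cubeIdxOf` of the block of the bond's source: `cubeOfFluctIdx F Mc (k+1) k K (b′, a) = cubeIdxOf F Mc k K (blockOf b′.src)`
(standing range). [cite: Balaban1987RG1, p.257, (0.3) p.252 (bookkeeping)] -/
theorem cubeOfFluctIdx_succ (Mc k K : ℕ) (hk : k ≤ (F.P K).m + (F.P K).K) (q : FluctIdx F k K) :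
    cubeOfFluctIdx F Mc (k + 1) k K q = cubeIdxOf F Mc k K (blockOf q.1.src) := by
  show cubeIdxAt F Mc (k + 1) K (blockOf (coarsenTo k (B15DeterminingSets.embIter k q.1.src))) = _
  rw [coarsenTo_embIter k hk]
  rfl

/-- The colour is not read: two fine coordinates on the same bond have the same cube. [cite: Balaban1988RG2Cluster, p.3 L24–31 (bookkeeping)] -/
theorem cubeOfFineIdx_eq_of_fst_eq (Ms j K : ℕ) {p p' : FineIdx F K} (h : p.1 = p'.1) :
    cubeOfFineIdx F Ms j K p = cubeOfFineIdx F Ms j K p' := by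
  rw [cubeOfFineIdx_apply, cubeOfFineIdx_apply, h]

/-- The colour is not read: two fluctuation coordinates on the same bond have the same cube. [cite: Balaban1988RG2Cluster, p.3 L24–31 (bookkeeping)] -/
theorem cubeOfFluctIdx_eq_of_fst_eq (Ms j k K : ℕ) {q q' : FluctIdx F k K} (h : q.1 = q'.1) :
    cubeOfFluctIdx F Ms j k K q = cubeOfFluctIdx F Ms j k K q' := by
  rw [cubeOfFluctIdx_apply, cubeOfFluctIdx_apply, h]

end Summit.QuantumFields.YangMills.Theorems.K0RecordFormatNames

end
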